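import Literature.NumberTheory.EllipticCurves.Kim2025.FineMainIdentitySkinnerUrban
import Literature.NumberTheory.EllipticCurves.BurungaleCastellaSkinner2025.CyclotomicMainTheoremIntegralProofs
import HarnessLib

/-!
# C.-H. Kim, arXiv:2505.09121v1, statement 3.17 for an elliptic curve AT EVERY HEIGHT-ONE PRIME on
# the Burungale–Castella–Skinner class — Kato's main identity `char_Λ(𝐇¹_Γ(T_pW)/Z) = char_Λ(X₀)`
# in the printed (FINE) currency from BCS 2025 Thm. 1.1.2 (b) (integral equality under (im)),
# PROVED over Kato's §17.13 package (theorems only)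

Topic `NumberTheory/EllipticCurves`, sub-directory `Kim2025`; namespace
`Literature.NumberTheory.EllipticCurves.Kim2025`.  Typing layer (cell `bsd-littype`, seat 09, gen 5);
companion of `FineMainIdentityOffP` (Thm. 3.19 (Wan)-slot off `(p)` via BCS 1.1.2 (a)) and
`FineMainIdentitySkinnerUrban` (Thm. 3.19 (SU) at every height-one prime).  HONEST FRAMING:
THEOREMS ONLY (0 definitions, 0 named facts, net debt 0); the research inputs are the tree's NAMED
facts passed as explicit hypotheses — `burungale_castella_skinner_charIdeal_eq_padicLFunction_integral`
(BCS 2025 Thm. 1.1.2 (b) in the tower-surjective special case of (im), refereed, IMRN 2025) resp.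
`BurungaleCastellaSkinner2025.thm112b_charIdeal_eq_padicLFunction_integral` (the same theorem with
(im) literal) together with the period comparison `realPeriodRat_eq_unit_mul_plusPeriod`
(Greenberg–Vatsal 2000 Rem. 3.4 / Mazur 1978), and `Kato2004.exists_divisibilityInputs_fineQuotient`
for the closing instance; nothing is booked; BSD is not advanced.

## What is printed, and what this file adds (read before citing)

[K25] Thm. 3.19 (held text `paper:arxiv-2505.09121`, §3.5.3, chunk p0014:L75–L90):

> **(SU)** If `ρ_f` has large image, `k ≡ 2 (mod p−1)`, and there exists a prime `ℓ` exactly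
> dividing `N` where `ρ̄_f` is ramified, then `ord_𝔓(char_Λ(H¹_Iw/Λκ^{Kato,∞}_1)) =
> ord_𝔓(char_Λ(Sel₀(ℚ_∞,W_f(1))^∨))` for every height one prime `𝔓` of `Λ`.
> **(Wan)** If `p ≥ 5` and `ρ̄_f` is irreducible, then [the same] for every height one prime `𝔓`
> except `πΛ`.  *Proof.* See [Kato], [Skinner–Urban], [Wan].  The latter two results concern the
> Iwasawa main conjecture with `p`-adic `L`-functions, which is equivalent to [statement 3.17] via
> the global Poitou–Tate duality [Kato].

So IN PRINT the prime `𝔓 = πΛ = (p)` is reached only on the (SU) class (a multiplicative `ℓ ∥ N`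
with `ρ̄` ramified at `ℓ`).  Burungale–Castella–Skinner, IMRN 2025 = arXiv:2405.00270v2,
Thm. 1.1.2 (b) (p. 2) print the INTEGRAL equality `ch_Λ(X^ord(E/ℚ_∞)) = (L_p(E/ℚ))` in `Λ` for
`p > 3` good ordinary, (irr_ℚ) and (im) — NO condition on the conductor (their Rem. 1.3.2) — and
(im) holds when every `ρ̄_{E,p^m}` is onto ("large image").  Feeding (b) instead of (a) into the
same Poitou–Tate dictionary (`fine_heightOne_of_charIdeal_eq_span_integral`, companion file)
removes the exception `πΛ` on the large-image class WITHOUT a multiplicative prime: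

* `fine_heightOne_of_bcsIntegral` — **for `E/ℚ`, `p ≥ 5` good ordinary, `E[p]` irreducible,
  `ρ̄_{E,p^m}` onto for all `m`: `ℓ_𝔭(𝐇¹_Γ/Z) = ℓ_𝔭(Y)` at EVERY height-one prime `𝔭` of `Λ`,
  `(p)` included**, for every §17.13 package `K` with fine quotient `π : X ↠ Y`, granted the tree
  fact `burungale_castella_skinner_charIdeal_eq_padicLFunction_integral`;
  `charIdeal_quotient_zeta_eq_charIdeal_fine_of_bcsIntegral` — the characteristic-ideal form
  **`char_Λ(𝐇¹_Γ/Z) = char_Λ(Y)`** (statement 3.17 for `E`, `X₀`-form, every height-one prime);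
  `exists_charIdeal_quotient_zeta_eq_of_bcsIntegral_of_fineQuotient` — the instance on the pinned
  `W.FineSelmerDualData` (modulo `exists_divisibilityInputs_fineQuotient` by name).
* `fine_heightOne_of_thm112b`, `charIdeal_quotient_zeta_eq_charIdeal_fine_of_thm112b` — the same
  from the (im)-literal transcription `thm112b_…` (registry A148; hypotheses `3 < p`, `GoodOrd`,
  `Irr`, `BigIm`, newform at level `N_E`, `ι g = ϖ · L_p(f,α)` for the Néron-normalised function)
  plus the period comparison `realPeriodRat_eq_unit_mul_plusPeriod` (`ϖ` is a `p`-adic unit, so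
  `(g)` has a generator `g'` with `ι g' = L_p(f,α)` — tree lemma `exists_span_eq_and_map_eq_C_inv_mul_iff`).

STATUS OF THE CLAIM RELATIVE TO [K25]: STRONGER than the printed (Wan) clause (which excludes
`πΛ`) and off the printed (SU) class — but NOT a new claim: it is the kernel composition of the
refereed BCS 2025 Thm. 1.1.2 (b) with Kato's §17.13 (the Poitou–Tate sentence of the proof of
Thm. 3.19), exactly as [K25] composes (a)-type results; recorded in the seat's OPEN-QUESTIONS-09 as
the answer to "is the exception `πΛ` of Thm. 3.19 (Wan) removable?" on the large-image class at
`p ≥ 5`.  Scope: good ordinary `p ≥ 5`; the non-ordinary / `p = 3` residue is untouched.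

## References
* C.-H. Kim (app. with R. Pollack), arXiv:2505.09121v1 (2025), statement 3.17 and Thm. 3.19 with
  its proof (§3.5.3). [Kim2025RefinedTNC]
* A. Burungale, F. Castella, C. Skinner, IMRN 2025 (rnaf082) = arXiv:2405.00270v2, Thm. 1.1.2 (b),
  (im), Rem. 1.3.2 (pp. 2–4). [BurungaleCastellaSkinner2025]
* R. Greenberg, V. Vatsal, Invent. Math. 142 (2000), §3 Rem. 3.4 (period ratio). [GreenbergVatsal2000]
* K. Kato, Astérisque 295 (2004), §17.13 (pp. 279–280). [Kato2004Asterisque]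
-/

noncomputable section

open scoped MatrixGroups ModularForm Classical

open CongruenceSubgroup Literature.NumberTheory.EllipticCurves.ModularForms
  Literature.NumberTheory.EllipticCurves Literature.NumberTheory.EllipticCurves.Module
  Literature.NumberTheory.EllipticCurves.IwasawaAlgebra
open Field Literature.NumberTheory.GaloisRepresentations
open Literature.NumberTheory.EllipticCurves.Kato2004
open Literature.NumberTheory.EllipticCurves.Kato2004.EulerSystemValues
open Literature.NumberTheory.EllipticCurves.Rank1Residual
open Literature.NumberTheory.EllipticCurves.BurungaleCastellaSkinner2025

universe u

namespace Literature.NumberTheory.EllipticCurves.Kim2025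

/-! ### From the tower-surjective transcription of BCS Thm. 1.1.2 (b) -/

section Package

variable {p : ℕ} [Fact p.Prime] {W : WeierstrassCurve ℚ} [W.IsElliptic] [W.IsGloballyMinimal]
  [ContinuousSMul ℤ_[p] (W.tateModule p)] {N : ℕ} [NeZero N] {f : CuspForm (Gamma0 N) 2}
  {κ : ZpExtension ℚ p} {γ : absoluteGaloisGroup ℚ}
  {I : IwasawaH1Data W p κ γ} {D : W.SelmerDualData κ γ}
  {Y : Type u} [AddCommGroup Y] [_root_.Module (IwasawaAlgebra p) Y]

/-- **Statement 3.17 of [K25] for an elliptic curve at EVERY height-one prime on the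
Burungale–Castella–Skinner class** — via BCS 2025 Thm. 1.1.2 (b) (refereed tree fact
`burungale_castella_skinner_charIdeal_eq_padicLFunction_integral`: `X(E/ℚ_∞)` torsion,
`char_Λ X = (g)`, `ι g = L_p(f,α)` in `Λ`): at a good ordinary `p ≥ 5` with `E[p]` irreducible and
`ρ̄_{E,p^m}` onto for all `m`, `ℓ_𝔭(𝐇¹_Γ/Z) = ℓ_𝔭(Y)` at EVERY height-one prime `𝔭` of `Λ`, the
prime `(p)` included and with NO multiplicative-prime hypothesis, for the cyclotomic `(κ, γ)` in the
cyclotomic variable, the newform `f` of `W`, every §17.13 package `K` with fine quotient `π : X ↠ Y`.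
(Print: Thm. 3.19 (Wan) gives this off `πΛ`; (SU) gives `πΛ` only with a ramified `ℓ ∥ N`.)
[cite: BurungaleCastellaSkinner2025, Thm. 1.1.2 (b) (p. 2 of arXiv:2405.00270v2)]
[cite: Kim2025RefinedTNC, statement 3.17 and proof of Thm. 3.19 (§3.5.3, chunk p0014:L43–L51, L88–L90)]
[cite: Kato2004Asterisque, §17.13 (p. 280)] -/
theorem fine_heightOne_of_bcsIntegral
    (hB : burungale_castella_skinner_charIdeal_eq_padicLFunction_integral)
    (hp : 5 ≤ p) (hord : IsOrdinaryAt W p) (hirr : W.HasIrreducibleModPGaloisRep p)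
    (htower : ∀ m : ℕ, W.HasSurjectiveModNGaloisRep (p ^ m : ℕ))
    (hκ : κ.IsCyclotomic) (hγ : κ.IsTopGenerator γ) (hγ' : IsCyclotomicVariable p γ)
    (hf : IsNewformOf W f) (K : DivisibilityInputs W p f κ γ I D)
    (π : D.X →ₗ[IwasawaAlgebra p] Y) (hπs : Function.Surjective π) (hπ : Function.Exact K.toX π)
    (𝔭 : PrimeSpectrum (IwasawaAlgebra p)) (h𝔭 : 𝔭.asIdeal.height = 1) :
    lengthAt (IwasawaAlgebra p) (I.H ⧸ K.Z) 𝔭 = lengthAt (IwasawaAlgebra p) Y 𝔭 := by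
  obtain ⟨hX, g, hιg, hchar⟩ :=
    hB W p κ γ f hp ((isOrdinaryAt_iff W p).1 hord).1 ((isOrdinaryAt_iff W p).1 hord).2 hirr htower
      hκ hγ hγ' hf D
  haveI : Module.Finite (IwasawaAlgebra p) D.X :=
    (WeierstrassCurve.SelmerDualData.module_finite_of_isCyclotomic (W := W) (κ := κ) hκ D) hγ
  exact fine_heightOne_of_charIdeal_eq_span_integral K hirr (padicLFunction_unitRoot_ne_zero hord hf)
    π hπs hπ hX hchar hιg 𝔭 h𝔭

/-- The characteristic-ideal form on the BCS class: **`char_Λ(𝐇¹_Γ(T_pW)/Z) = char_Λ(Y)`**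
(statement 3.17 of [K25] for `E` in the `X₀`-form, every height-one prime) — hypotheses as in
`fine_heightOne_of_bcsIntegral`. [cite: BurungaleCastellaSkinner2025, Thm. 1.1.2 (b) (p. 2 of arXiv:2405.00270v2)]
[cite: Kim2025RefinedTNC, statement 3.17 (§3.5.3, chunk p0014:L43–L51)] [cite: Kato2004Asterisque, §17.13 (p. 280)] -/
theorem charIdeal_quotient_zeta_eq_charIdeal_fine_of_bcsIntegral
    (hB : burungale_castella_skinner_charIdeal_eq_padicLFunction_integral)
    (hp : 5 ≤ p) (hord : IsOrdinaryAt W p) (hirr : W.HasIrreducibleModPGaloisRep p)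
    (htower : ∀ m : ℕ, W.HasSurjectiveModNGaloisRep (p ^ m : ℕ))
    (hκ : κ.IsCyclotomic) (hγ : κ.IsTopGenerator γ) (hγ' : IsCyclotomicVariable p γ)
    (hf : IsNewformOf W f) (K : DivisibilityInputs W p f κ γ I D)
    (π : D.X →ₗ[IwasawaAlgebra p] Y) (hπs : Function.Surjective π) (hπ : Function.Exact K.toX π) :
    charIdeal (IwasawaAlgebra p) (I.H ⧸ K.Z) = charIdeal (IwasawaAlgebra p) Y :=
  charIdeal_eq_of_lengthAt_eq fun 𝔭 h𝔭 ↦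
    fine_heightOne_of_bcsIntegral hB hp hord hirr htower hκ hγ hγ' hf K π hπs hπ 𝔭 h𝔭

end Package

/-! ### From the (im)-literal transcription `thm112b` with the period comparison -/

section Thm112b

variable {p : ℕ} [Fact p.Prime] {W : WeierstrassCurve ℚ} [W.IsElliptic] [W.IsGloballyMinimal]
  [ContinuousSMul ℤ_[p] (W.tateModule p)] [NeZero (W.conductorNorm ℤ)]
  {f : CuspForm (Gamma0 (W.conductorNorm ℤ)) 2}
  {κ : ZpExtension ℚ p} {γ : absoluteGaloisGroup ℚ}
  {I : IwasawaH1Data W p κ γ} {D : W.SelmerDualData κ γ}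
  {Y : Type u} [AddCommGroup Y] [_root_.Module (IwasawaAlgebra p) Y]

/-- A prime `p > 3` is `≥ 5`. [cite: NeukirchSchmidtWingberg2008, Ch. V §1 (bookkeeping)] -/
private theorem five_le_of_three_lt (hp : 3 < p) : 5 ≤ p := by
  by_contra h
  have h4 : p = 4 := by omega
  exact absurd (h4 ▸ (Fact.out : p.Prime)) (by decide)

omit [ContinuousSMul ℤ_[p] (W.tateModule p)] in
/-- **`Ω⁺_f`-normalised integral generator from `thm112b` and the period comparison.**  If BCS
Thm. 1.1.2 (b) holds in the (im)-literal transcription (`ι g = ϖ · L_p(f,α)` for every rational `ϖ`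
with `ϖ · Ω_E = Ω⁺_f`) and `Ω_E = u · Ω⁺_f` with `|u|_p = 1` (`realPeriodRat_eq_unit_mul_plusPeriod`),
then for `p > 3` good ordinary with (irr_ℚ), (im): `X(E/ℚ_∞)` is torsion and `char_Λ X = (g')` with
`ι g' = L_p(f,α)` (take `ϖ = u⁻¹` and rescale by the unit `C(u)`).
[cite: BurungaleCastellaSkinner2025, Thm. 1.1.2 (b) (p. 2 of arXiv:2405.00270v2)]
[cite: GreenbergVatsal2000, §3, Remark 3.4] -/
theorem exists_charIdeal_eq_span_integral_of_thm112b
    (hB : thm112b_charIdeal_eq_padicLFunction_integral) (hΩ : realPeriodRat_eq_unit_mul_plusPeriod)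
    (hp : 3 < p) (hord : GoodOrd W p) (hirr : Irr W p) (him : BigIm W p)
    (hκ : κ.IsCyclotomic) (hγ : κ.IsTopGenerator γ) (hγ' : IsCyclotomicVariable p γ)
    (hf : IsNewformOf W f) (D : W.SelmerDualData κ γ) :
    D.IsTorsion ∧ ∃ g : IwasawaAlgebra p, D.charIdeal = Ideal.span {g} ∧
      iwasawaToPowerSeries p g = padicLFunction f (unitRoot W p : ℚ_[p]) := by
  obtain ⟨u, hu1, hΩu⟩ := hΩ W p (five_le_of_three_lt hp) hord.1 hirr f hf
  have hu0 : (u : ℚ_[p]) ≠ 0 := fun h0 ↦ by simp [h0] at hu1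
  have hu0' : u ≠ 0 := fun h0 ↦ hu0 (by simp [h0])
  have hϖ : ((u⁻¹ : ℚ) : ℝ) * W.realPeriodRat = plusPeriod f := by
    rw [hΩu, Rat.cast_inv, ← mul_assoc, inv_mul_cancel₀ (by exact_mod_cast hu0'), one_mul]
  obtain ⟨htors, g, hI, hg⟩ := hB W p hp hord hirr him κ γ hκ hγ hγ' f hf u⁻¹ hϖ D
  refine ⟨htors, ?_⟩
  rw [Rat.cast_inv] at hg
  exact (exists_span_eq_and_map_eq_C_inv_mul_iff p hu1 _ _).1 ⟨g, hI, hg⟩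

/-- **Statement 3.17 of [K25] for `E` at EVERY height-one prime from `thm112b` (BCS Thm. 1.1.2 (b),
(im) literal) and the period comparison**: for `p > 3` good ordinary with (irr_ℚ), (im),
`ℓ_𝔭(𝐇¹_Γ/Z) = ℓ_𝔭(Y)` at every height-one `𝔭`, `(p)` included, for the newform `f` of `W` at level
`N_E`, the cyclotomic `(κ, γ)`, every §17.13 package `K` with fine quotient `π : X ↠ Y`.
[cite: BurungaleCastellaSkinner2025, Thm. 1.1.2 (b) (p. 2 of arXiv:2405.00270v2)]
[cite: GreenbergVatsal2000, §3, Remark 3.4]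
[cite: Kim2025RefinedTNC, statement 3.17 and proof of Thm. 3.19 (§3.5.3, chunk p0014:L43–L51, L88–L90)]
[cite: Kato2004Asterisque, §17.13 (p. 280)] -/
theorem fine_heightOne_of_thm112b
    (hB : thm112b_charIdeal_eq_padicLFunction_integral) (hΩ : realPeriodRat_eq_unit_mul_plusPeriod)
    (hp : 3 < p) (hord : GoodOrd W p) (hirr : Irr W p) (him : BigIm W p)
    (hκ : κ.IsCyclotomic) (hγ : κ.IsTopGenerator γ) (hγ' : IsCyclotomicVariable p γ)
    (hf : IsNewformOf W f) (K : DivisibilityInputs W p f κ γ I D)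
    (π : D.X →ₗ[IwasawaAlgebra p] Y) (hπs : Function.Surjective π) (hπ : Function.Exact K.toX π)
    (𝔭 : PrimeSpectrum (IwasawaAlgebra p)) (h𝔭 : 𝔭.asIdeal.height = 1) :
    lengthAt (IwasawaAlgebra p) (I.H ⧸ K.Z) 𝔭 = lengthAt (IwasawaAlgebra p) Y 𝔭 := by
  obtain ⟨hX, g, hchar, hιg⟩ :=
    exists_charIdeal_eq_span_integral_of_thm112b hB hΩ hp hord hirr him hκ hγ hγ' hf D
  haveI : Module.Finite (IwasawaAlgebra p) D.X :=
    (WeierstrassCurve.SelmerDualData.module_finite_of_isCyclotomic (W := W) (κ := κ) hκ D) hγ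
  have hord' : IsOrdinaryAt W p := (isOrdinaryAt_iff W p).2 ⟨hord.1, hord.2⟩
  exact fine_heightOne_of_charIdeal_eq_span_integral K hirr (padicLFunction_unitRoot_ne_zero hord' hf)
    π hπs hπ hX hchar hιg 𝔭 h𝔭

/-- The characteristic-ideal form from `thm112b`: **`char_Λ(𝐇¹_Γ(T_pW)/Z) = char_Λ(Y)`** —
hypotheses as in `fine_heightOne_of_thm112b`.
[cite: BurungaleCastellaSkinner2025, Thm. 1.1.2 (b) (p. 2 of arXiv:2405.00270v2)]
[cite: GreenbergVatsal2000, §3, Remark 3.4] [cite: Kim2025RefinedTNC, statement 3.17 (§3.5.3, chunk p0014:L43–L51)]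
[cite: Kato2004Asterisque, §17.13 (p. 280)] -/
theorem charIdeal_quotient_zeta_eq_charIdeal_fine_of_thm112b
    (hB : thm112b_charIdeal_eq_padicLFunction_integral) (hΩ : realPeriodRat_eq_unit_mul_plusPeriod)
    (hp : 3 < p) (hord : GoodOrd W p) (hirr : Irr W p) (him : BigIm W p)
    (hκ : κ.IsCyclotomic) (hγ : κ.IsTopGenerator γ) (hγ' : IsCyclotomicVariable p γ)
    (hf : IsNewformOf W f) (K : DivisibilityInputs W p f κ γ I D)
    (π : D.X →ₗ[IwasawaAlgebra p] Y) (hπs : Function.Surjective π) (hπ : Function.Exact K.toX π) :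
    charIdeal (IwasawaAlgebra p) (I.H ⧸ K.Z) = charIdeal (IwasawaAlgebra p) Y :=
  charIdeal_eq_of_lengthAt_eq fun 𝔭 h𝔭 ↦
    fine_heightOne_of_thm112b hB hΩ hp hord hirr him hκ hγ hγ' hf K π hπs hπ 𝔭 h𝔭

end Thm112b

/-! ### The instance on the pinned fine Selmer dual -/

section FineSelmerDual

variable {p : ℕ} [Fact p.Prime] {W : WeierstrassCurve ℚ} [W.IsElliptic] [W.IsGloballyMinimal]
  [ContinuousSMul ℤ_[p] (W.tateModule p)] {N : ℕ} [NeZero N] {f : CuspForm (Gamma0 N) 2}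
  {κ : ZpExtension ℚ p} {γ : absoluteGaloisGroup ℚ}

/-- **Kato's main identity in the `X₀`-form (statement 3.17 of [K25] for `E/ℚ`, every height-one
prime) on the Burungale–Castella–Skinner class with large image, on the pinned objects
`𝐇¹_Γ(T_pW)` and `X₀(E/ℚ_∞) = Y.X`, MODULO the named facts
`burungale_castella_skinner_charIdeal_eq_padicLFunction_integral` (BCS Thm. 1.1.2 (b), refereed) and
`Kato2004.exists_divisibilityInputs_fineQuotient`:** at a good ordinary `p ≥ 5` with `E[p]`
irreducible and `ρ̄_{E,p^m}` onto for all `m`, there are a package `K` and a fine quotient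
`π : X ↠ X₀` with `char_Λ(I.H/K.Z) = Y.charIdeal` and `ℓ_𝔭(I.H/K.Z) = ℓ_𝔭(Y.X)` at every
height-one `𝔭`. [cite: BurungaleCastellaSkinner2025, Thm. 1.1.2 (b) (p. 2 of arXiv:2405.00270v2)]
[cite: Kim2025RefinedTNC, statement 3.17 and proof of Thm. 3.19 (§3.5.3, chunk p0014:L43–L51, L88–L90)]
[cite: Kato2004Asterisque, (14.9.3) (p. 240) and §17.13 (pp. 279–280)] -/
theorem exists_charIdeal_quotient_zeta_eq_of_bcsIntegral_of_fineQuotient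
    (hB : burungale_castella_skinner_charIdeal_eq_padicLFunction_integral)
    (hfine : exists_divisibilityInputs_fineQuotient) (hp : 5 ≤ p) (hord : IsOrdinaryAt W p)
    (hirr : W.HasIrreducibleModPGaloisRep p)
    (htower : ∀ m : ℕ, W.HasSurjectiveModNGaloisRep (p ^ m : ℕ))
    (hκ : κ.IsCyclotomic) (hγ : κ.IsTopGenerator γ) (hγ' : IsCyclotomicVariable p γ)
    (hf : IsNewformOf W f)
    (I : IwasawaH1Data W p κ γ) (D : W.SelmerDualData κ γ) (Y : W.FineSelmerDualData κ γ) :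
    ∃ (K : DivisibilityInputs W p f κ γ I D) (π : D.X →ₗ[IwasawaAlgebra p] Y.X),
      Function.Surjective π ∧ Function.Exact K.toX π ∧
      charIdeal (IwasawaAlgebra p) (I.H ⧸ K.Z) = Y.charIdeal ∧
      ∀ 𝔭 : PrimeSpectrum (IwasawaAlgebra p), 𝔭.asIdeal.height = 1 →
        lengthAt (IwasawaAlgebra p) (I.H ⧸ K.Z) 𝔭 = lengthAt (IwasawaAlgebra p) Y.X 𝔭 := by
  have hp2 : p ≠ 2 := by rintro rfl; norm_num at hp
  obtain ⟨K, π, hπs, hπ⟩ := hfine W p f κ γ hp2 hord hκ hγ hγ' hf I D Y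
  exact ⟨K, π, hπs, hπ,
    charIdeal_quotient_zeta_eq_charIdeal_fine_of_bcsIntegral hB hp hord hirr htower hκ hγ hγ' hf K
      π hπs hπ,
    fun 𝔭 h𝔭 ↦ fine_heightOne_of_bcsIntegral hB hp hord hirr htower hκ hγ hγ' hf K π hπs hπ 𝔭 h𝔭⟩

end FineSelmerDual

end Literature.NumberTheory.EllipticCurves.Kim2025

end
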